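import Summits.HodgeConjecture.HodgeConjecture.Theorems.H413ArchTorusCentreSwap
import Summits.HodgeConjecture.HodgeCM.Model.ArchKTypeOfTorus
import HarnessLib

/-!
# FLOOR-0 P4, S4b (N)-row archimedean inputs — the `U(W)(L⁺ ⊗ ℝ)`-torus acts on the slot family through the splitting of record by
# (F1)'s centre eigen-character `lineC ∘ det_∞` (the `heig` of ★ `ThetaNonvanishing.dist_ne_zero_of_rallis_of_eigen_of_finCoeff`)

Cell hodgecm-mathlib (D-0151), FLOOR 0, crux item H413 = stmt-HodgeConjecture-24833; programme P4, line
`Cruxes/H413/Lines/F0_P4AdmissibleOccursInH1.lean` (ED. 3), stub S4b `stub_T3a_holThetaAtAdmissibleLineOfRallisAt` — the archimedean desk (A), row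
`heig` of the NON-VANISHING reduction (seat (ii), F0P4-p02: ★ `Theorems/H413ThetaDistNonvanishingOfRallis`).  Author F0P4-p04 (g2).
`--supports stmt-HodgeConjecture-24833 --as helper`.  KERNEL ONLY: theorems over LANDED theorems; no `sorry`, no definition.

WHY.  ★ `dist_ne_zero_of_rallis_of_eigen_of_finCoeff` needs `heig : ∀ a : U(⟨d⟩)(L⁺ ⊗ ℝ), archWeilRep … s … (1, a) (D.Φarch ℓ) = χ_∞ a • D.Φarch ℓ`
at the splitting of record `s = splittingOf hGR₀` and the slot family `D.Φarch = blockFamilyOfAt …` (★ `ThetaDistAtLine.distDatumAt_Φarch`, rfl).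
★ `Theorems/H413ArchTorusCentreSwap` (F0P4-p07 (g0)) reduces the `U(W)`-torus of a LINE to the archimedean CENTRE of `U(V)`
(`archWeilRep_one_line_eq_smul_of_center`: `heig` with `χ_∞ := χ_c ∘ det_∞` from the centre character `χ_c`), and ★ `HodgeCM/Model/ArchKTypeOfTorus`
`cmArchWeilRep_center_blockFamilyOfAt` says the centre `t · 1_V` acts on EVERY member of the slot family by (F1)'s `lineC V d hGR₀ t` (★ `ArchLineDatumOf`).
This file assembles them (the model's `cmArchWeilRep … hGR₀` IS `archWeilRep … (splittingOf hGR₀) _` and `cmArchCenter = archCenter`, both `rfl`):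

* `det_diagonal_lineVec_ne_zero` — `det (diagonal (lineVec d)) = d ≠ 0` (the `hJW` of the centre swap);
* **`cmArchWeilRep_one_blockFamilyOfAt`** — `ω_{s₀}(1, a) Φ_∞(ℓ) = lineC V d hGR₀ (det_∞ a) • Φ_∞(ℓ)` for every `a ∈ U(⟨d⟩)(L⁺ ⊗ ℝ)` and every
  covector `ℓ`: the `heig` row with **`χ_∞ := lineC V d hGR₀ ∘ archDet`** — and by the centre identity (CC₀) of ★ `Theorems/H413ThetaDistAtLineArchTypes`
  ∕ `…CCOfWeightOne` this `χ_∞` is `(ĉ_V ∘ centre)⁻¹ = ĉ_W⁻¹` at `∞`, the archimedean component FORCED on the `(χ)`-row's `χM` (F0P4-p01 SEAT-i MEMO v4 §4);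
* `lineC_mul_conj` — `lineC t · conj (lineC t) = 1` (the `hχu` row for this `χ_∞`: (F1)'s `lineCenterChar` and the place character are circle-valued);
* `integral_mul_conj_ne_zero_of_ne_zero` ∕ **`integral_linePhi_mul_conj_ne_zero`** — the `hΦ` row: `∫ Φ_∞ · conj Φ_∞ dμ_∞ ≠ 0` for a non-zero Schwartz
  vector and an additive Haar measure (the pinned harmonic vector `linePhi ≠ 0`, ★ `linePhi_ne_zero`).

HC_CM is proved only modulo the printed citations until rung 0 closes.

## References
* [Liu2021] Y. Liu, Camb. J. Math. 9 (2021), App. D §D.1 Step 3 (l. 5219–5221), Lem. D.2; proof of Prop. 4.13 (l. 2145).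
* [Li1992] J.-S. Li, J. reine angew. Math. 428 (1992), p. 178, Thm 2.1 (26)–(27) (the archimedean factor of the inner product).
* [GelbartRogawski1991] §3.1 p. 454–455; [Weil1964] Chap. III n° 37–38; [Mok2014] §1 Notation p. 5 (`E¹ · 1_N`).
* Tree (all ★): `Theorems/H413ArchTorusCentreSwap` (`archWeilRep_one_line_eq_smul_of_center`), `HodgeCM/Model/ArchKTypeOfTorus` (`cmArchWeilRep_center_blockFamilyOfAt`),
  `HodgeCM/Model/ArchLineDatumOf_2` (`lineC`, `lineC_def`), `Literature/NumberTheory/Automorphic/UnitaryGroupArchCenter` (`cmArchCenter_eq`).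
-/

set_option autoImplicit false
set_option linter.dupNamespace false

noncomputable section

open NumberField hiding relNormOneIdeles relNormOneRat probHaarRelNormOneQuot
open _root_.NumberField.InfinitePlace _root_.NumberField.mixedEmbedding MeasureTheory MulAction IsDedekindDomain
open scoped Matrix TensorProduct Classical SchwartzMap ComplexConjugate
open Literature.NumberTheory.Automorphic Literature.NumberTheory.Automorphic.UnitaryGroup Literature.NumberTheory.Weil1964
open Literature.NumberTheory.GelbartRogawski1991 Literature.NumberTheory.GelbartRogawski1991.UnitaryDualPair
open Literature.RepresentationTheory.KonnoKonno2007 Literature.RepresentationTheory.KonnoKonno2007.RealDualPair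
open Literature.Analysis.SegalBargmann
open HodgeCM HodgeCM.Adelic HodgeCM.PerL34 HodgeCM.Model HodgeCM.Model.HypCensus HodgeCM.Model.ArchSideTerm

namespace Summit.HodgeConjecture.HodgeConjecture.Cruxes.H413.ThetaDistAtLine

variable {L : CMField} {ι₁ : L →+* ℂ} (V : HermSpace3 L ι₁)
variable (d : (L : Type)) (hd : IsCMField.complexConj L d = d) (hd0 : d ≠ 0)
  (hGRd : (cmSplittingDatum (L : Type) (e₁) (frameD V) (frameD_real V) (frameD_ne V) (lineVec (L : Type) d) (fun _ => hd)
    (fun _ => hd0)).CompatibleSplitting)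
  {S' : Type} [Fintype S'] [DecidableEq S']
  (eR : PosIdx (cmXW (L : Type) (frameD V) (lineVec (L : Type) d) (fun _ => hd) ι₁ (HypCensus.cmPlace (L : Type) ι₁)) ≃ Unit)
  (eS : NegIdx (cmXW (L : Type) (frameD V) (lineVec (L : Type) d) (fun _ => hd) ι₁ (HypCensus.cmPlace (L : Type) ι₁)) ≃ S')

omit V in
include hd0 in
/-- the Gram matrix `diagonal (lineVec d)` of the line `⟨d⟩` has determinant `d ≠ 0`. [folklore] -/
theorem det_diagonal_lineVec_ne_zero : (Matrix.diagonal (lineVec (L : Type) d)).det ≠ 0 := by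
  rw [Matrix.det_diagonal, Fin.prod_univ_one]
  exact hd0

/-- **THE `U(W)`-TORUS ACTS ON THE SLOT FAMILY BY `lineC ∘ det_∞`** (the `heig` row of ★ `ThetaNonvanishing.dist_ne_zero_of_rallis_of_eigen_of_finCoeff` at
the splitting of record, `χ_∞ := lineC V d hGR₀ ∘ archDet`): for every `a ∈ U(⟨d⟩)(L⁺ ⊗ ℝ)` and every covector `ℓ`,
`ω_{s₀}(1, a) Φ_∞(ℓ) = lineC (det_∞ a) • Φ_∞(ℓ)` — the torus of a line is the centre of `U(V)` (★ `archWeilRep_one_line_eq_smul_of_center`), which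
acts on the family by (F1)'s centre eigen-character (★ `cmArchWeilRep_center_blockFamilyOfAt`).
[cite: Liu2021, App. D §D.1 Step 3 (l. 5219–5221); Lem. D.2] [cite: GelbartRogawski1991, §3.1 p. 454–455] -/
theorem cmArchWeilRep_one_blockFamilyOfAt
    (a : UnitaryGroup.arch (↥(maximalRealSubfield L)) (L : Type) (IsCMField.complexConj L) 1 (Matrix.diagonal (lineVec (L : Type) d)))
    (ℓ : Module.Dual ℂ (Fin 2 → ℂ)) :
    cmArchWeilRep (L : Type) e₁ (frameD V) (frameD_real V) (frameD_ne V) (lineVec (L : Type) d) (fun _ => hd) (fun _ => hd0) hGRd (1, a)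
        (blockFamilyOfAt (L : Type) e₁ (frameD V) (frameD_real V) (frameD_ne V) (lineVec (L : Type) d) (fun _ => hd) (fun _ => hd0) ι₁
          (blockPosEquiv V) (blockNegEquiv V) eR eS (degOnePDual S') (binvPi 1) ℓ) =
      lineC V d hd hd0 hGRd
          (UnitaryGroup.archDet (↥(maximalRealSubfield L)) (L : Type) (IsCMField.complexConj L) 1 (Matrix.diagonal (lineVec (L : Type) d))
            (Algebra.IsQuadraticExtension.finrank_eq_two _ (L : Type)) (IsCMField.complexConj_ne_one (K := (L : Type)))
            (det_diagonal_lineVec_ne_zero d hd0) a) •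
        blockFamilyOfAt (L : Type) e₁ (frameD V) (frameD_real V) (frameD_ne V) (lineVec (L : Type) d) (fun _ => hd) (fun _ => hd0) ι₁
          (blockPosEquiv V) (blockNegEquiv V) eR eS (degOnePDual S') (binvPi 1) ℓ :=
  Summit.HodgeConjecture.HodgeConjecture.Cruxes.H413.ThetaNonvanishing.archWeilRep_one_line_eq_smul_of_center
    (↥(maximalRealSubfield L)) (L : Type) (IsCMField.complexConj L) (Algebra.IsQuadraticExtension.finrank_eq_two _ (L : Type))
    (IsCMField.complexConj_ne_one (K := (L : Type))) 3 (Matrix.diagonal (frameD V)) (Matrix.diagonal (lineVec (L : Type) d)) e₁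
    (complexConj_imagUnit (L : Type)) (imagUnit_ne_zero (L : Type)) (imagUnit_mul_self (L : Type))
    (realDiagonal_isSymm (L : Type) (frameD V) (frameD_real V)) (realDiagonal_isSymm (L : Type) (lineVec (L : Type) d) (fun _ => hd))
    (isUnit_det_realDiagonal (L : Type) (frameD V) (frameD_real V) (frameD_ne V))
    (isUnit_det_realDiagonal (L : Type) (lineVec (L : Type) d) (fun _ => hd) (fun _ => hd0))
    (realDiagonal_map (L : Type) (frameD V) (frameD_real V)).symm (realDiagonal_map (L : Type) (lineVec (L : Type) d) (fun _ => hd)).symm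
    (cmSplittingOf (L : Type) e₁ (frameD V) (frameD_real V) (frameD_ne V) (lineVec (L : Type) d) (fun _ => hd) (fun _ => hd0) hGRd)
    (proj_cmSplittingOf (L : Type) e₁ (frameD V) (frameD_real V) (frameD_ne V) (lineVec (L : Type) d) (fun _ => hd) (fun _ => hd0) hGRd)
    (fun y => cmArchWeilRep_center_blockFamilyOfAt V d hd hd0 hGRd eR eS y ℓ) (det_diagonal_lineVec_ne_zero d hd0) a

/-- **`hχu` for `χ_∞ := lineC ∘ det_∞`**: (F1)'s centre eigen-character is circle-valued, `lineC t · conj (lineC t) = 1`. [folklore] -/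
theorem lineC_mul_conj (t : ↥(Literature.NumberTheory.Automorphic.relNormOneInfUnits (↥(maximalRealSubfield L)) L)) :
    lineC V d hd hd0 hGRd t * conj (lineC V d hd hd0 hGRd t) = 1 := by
  rw [lineC_def, map_mul, mul_mul_mul_comm, ← Circle.coe_inv_eq_conj, ← Circle.coe_inv_eq_conj, ← Circle.coe_mul, ← Circle.coe_mul,
    mul_inv_cancel, mul_inv_cancel, Circle.coe_one, mul_one]


/-! ## The `hΦ` row: a non-zero archimedean Schwartz vector has non-zero `L²`-mass -/

section Mass

variable {X : Type*} [NormedAddCommGroup X] [NormedSpace ℝ X] [FiniteDimensional ℝ X] [MeasurableSpace X] [BorelSpace X]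
  (μ : Measure X) [μ.IsAddHaarMeasure]

omit V in
/-- **`hΦ`**: for a non-zero Schwartz function `Φ` and an additive Haar measure `μ`, `∫ Φ · conj Φ dμ ≠ 0` (the integrand is `‖Φ‖² ≥ 0`, continuous,
integrable, and positive on the non-empty open support of `Φ`).  The `hΦ` row of ★ `ThetaNonvanishing.dist_ne_zero_of_rallis_of_eigen_of_finCoeff` for the
slot family at `ℓ = ⟨e₀, ·⟩` (`linePhi ≠ 0`, ★ `linePhi_ne_zero`). [folklore] -/
theorem integral_mul_conj_ne_zero_of_ne_zero (Φ : 𝓢(X, ℂ)) (hΦ : Φ ≠ 0) :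
    ∫ x, Φ x * conj (Φ x) ∂μ ≠ 0 := by
  have hf : (fun x => Φ x * conj (Φ x)) = fun x => ((‖Φ x‖ ^ 2 : ℝ) : ℂ) := by
    funext x
    rw [Complex.mul_conj, Complex.normSq_eq_norm_sq]
  rw [hf, integral_complex_ofReal, Complex.ofReal_ne_zero]
  -- integrability of `‖Φ‖²`: bounded times integrable
  have hint : Integrable (fun x => ‖Φ x‖ ^ 2) μ := by
    have h1 : Integrable (fun x => ‖Φ x‖) μ := Φ.integrable.norm
    have h2 : Integrable (fun x => ‖Φ x‖ * ‖Φ x‖) μ :=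
      h1.bdd_mul h1.aestronglyMeasurable (Filter.Eventually.of_forall fun x => by
        rw [Real.norm_eq_abs, abs_norm]
        exact SchwartzMap.norm_le_seminorm ℝ Φ x)
    exact h2.congr (Filter.Eventually.of_forall fun x => by simp only [sq])
  have hpos : 0 < ∫ x, ‖Φ x‖ ^ 2 ∂μ := by
    rw [integral_pos_iff_support_of_nonneg (fun x => sq_nonneg _) hint]
    have hsupp : Function.support (fun x => ‖Φ x‖ ^ 2) = Function.support Φ := by
      ext x
      simp only [Function.mem_support, ne_eq, pow_eq_zero_iff (two_ne_zero), norm_eq_zero]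
    rw [hsupp]
    obtain ⟨x₀, hx₀⟩ : ∃ x₀, Φ x₀ ≠ 0 := by
      by_contra h
      exact hΦ (SchwartzMap.ext fun x => not_not.mp (not_exists.mp h x))
    exact (Φ.continuous.isOpen_support).measure_pos μ ⟨x₀, hx₀⟩
  exact hpos.ne'

/-- **`hΦ` for the pinned harmonic vector of the line**: `∫ linePhi · conj linePhi dμ ≠ 0`. [folklore] -/
theorem integral_linePhi_mul_conj_ne_zero
    (hpos : 0 < cmXW (L : Type) (frameD V) (lineVec (L : Type) d) (fun _ => hd) ι₁ (HypCensus.cmPlace (L : Type) ι₁) 0)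
    [BorelSpace (Fin 3 → mixedSpace (↥(maximalRealSubfield L)))]
    (μE : Measure (Fin 3 → mixedSpace (↥(maximalRealSubfield L)))) [μE.IsAddHaarMeasure] :
    ∫ x, linePhi V d hd hd0 hpos x * conj (linePhi V d hd hd0 hpos x) ∂μE ≠ 0 :=
  integral_mul_conj_ne_zero_of_ne_zero μE _ (linePhi_ne_zero V d hd hd0 hpos)

end Mass

end Summit.HodgeConjecture.HodgeConjecture.Cruxes.H413.ThetaDistAtLine

end
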